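import Literature.MathematicalPhysics.QuantumFieldTheory.Balaban1983to89.B9Eq386ResolventBoundZd

/-!
# `Balaban1983to89.B9Eq386GreenContinuityZd` — [Balaban1985BackgroundPropagators] (3.86) p. 407 ∕ Thm 3.11 p. 416 («G_□(e^{iηA}) = G_□(1)(I − V(A)G_□(1))⁻¹»,
# «convergence is in the operator norm for α₁ sufficiently small»), ITS QUALITATIVE CONTENT AT THE `ℤᵈ × 𝔸` CARRIER: THE GENUINE PROPAGATOR `G_𝔤(U₀) = (□₀Δ_a(U₀)□₀)⁻¹`
# IS CONTINUOUS IN THE BACKGROUND IN `L²_τ`-OPERATOR NORM ALONG THE SMALL-FIELD CLASS; in particular `G_𝔤(U₀) → G_𝔤(1)` as the background flattens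

statement-level skeleton of published theorems with citation tags; proofs where landed; nothing here is a claim about the
Yang–Mills mass gap

`[Balaban1985BackgroundPropagators]` ("B9", CMP **99** (1985) 389–434) p. 407 (3.84)–(3.86) and p. 416 (proof of Thm 3.11), quoted in `B9Eq386ResolventBoundZd`:
(3.86)'s series converges in operator norm, its `n ≥ 1` tail is `O(α₁)` by (3.85).  This file proves the qualitative («`→ 0`») form for the genuine four-letter `Δ_a`
at the `ℤᵈ` frame: second resolvent identity + the uniform coercivity constant + the continuity of the letters in the background; NO rate (no (3.85)).  PDF held:
`paper:balaban1985-cmp99-background-propagators` pp. 407, 416 (re-read by this seat, 2026-08-28).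

CITATION HEADER (lean-in-tree rule).  Cell `pub-ymgap` (YM Track A, D-0062 ∕ D-0149), node N06 = [B9], width seat `pub-ymgap-dag-n06-w4` (g4), CLAIM-5 ∕ INTENT-5.
Inputs BY NAME: this seat's g4 `B9Eq386ResolventBoundZd.bondPair_gopZdH_sub_self_le`, `B9Thm33GreenL2BoundCubeZd.bondPair_gopZdH_self_le_of_coercive_of_mem`,
`B9Thm311CoerciveCompactZd.exists_coercive_and_regularAtH_of_pdevOn_lt_cube`, `B9Eq335UnitaryClassCompactZd.continuousWithinAt_bondPair_deltaAOf₂`, g3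
`B9Thm311PosDefOpenRegimeZd.lettersContinuousWithinAt_opsAllZd_cube_reg17UnivP`, dag-n06-w2 g3 `B9Eq326DeltaAHermitianZdCurved.linear_herm_on_reg17UnivP`, dag-n06-b
`B9Eq327GreenZdHerm` (`gopZdH`, `restrictLinH`, `HermPreservingAt`), g2 `B9Eq327GreenZd`.

WHAT IS PROVED (kernel, 0 sorry; theorems only — no `def`, `instance`, `notation`).
* §1 (`[folklore]`) ★★ `eventually_abs_le_of_entries_tendsto_zero` — bilinear forms `r x` on a finite-dimensional real space whose ENTRIES tend to `0` along a filter `l`,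
  positive definite reference form `N`: `∀ ε > 0, ∀ᶠ x in l, ∀ v w, |r x v w| ≤ ε·(N v v + N w w)` (coordinate sphere; `2|c||e| ≤ |c|² + |e|²`).
* §2 (carrier, ANY record `o`, finite `Ω₀`) ★★★ `eventually_bondPair_gopZdH_sub_le` — on a set `S` with `RegularAtH`, `LinearOnDomAt`, `HermPreservingAt`, ONE coercivity
  constant `c`, letters continuous within `S` at `V ∈ S` on `E_𝔤(Ω₀)`: `∀ ε > 0, ∀ᶠ U in 𝓝[S] V, ∀ J ∈ E_𝔤(Ω₀), ⟨G_𝔤(U)J − G_𝔤(V)J, ·⟩_τ ≤ ε·⟨J, J⟩_τ`.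
* §3 (cube members, genuine `opsAllZd` at `cubeLamBP`) ★★★★ `eventually_bondPair_gopZdH_sub_le_cube` — with the member's `α` and
  `S = {unitary ∧ (1.7) on ℤᵈ at window α_Q∕L² ∧ pdevOn(□₀ ± 3) < α}`: at EVERY `V ∈ S`, `G_𝔤(U₀) → G_𝔤(V)` in `L²_τ`-operator norm as `U₀ → V` within `S`;
  ★★★ `eventually_bondPair_gopZdH_sub_one_le_cube` (`V = 1`: the curved propagator tends to the flat one).

HONEST SCOPE.  (i) QUALITATIVE: no rate in the plaquette size (print's `O(α₁)` needs (3.85)); `L²_τ` currency only.  (ii) Product topology on the backgrounds («near `V`» =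
finitely many bond variables close), within the regime set where the letters are print's and continuous.  (iii) `α, c` MEMBER-DEPENDENT, NON-QUANTITATIVE.  (iv) `τ`
is a PARAMETER; no instance.  (v) A6: `1 ∈ S` at every member; at `U₀ = V` the bound reads `0 ≤ ε⟨J,J⟩`.  (vi) Count-neutral helper (`--supports` the K1 item of record);
N05 ∕ N06 NOT discharged; K1 NOT closed; one finite `𝕋⁴` programme at fixed `ε`, Bałaban as printed; R4 closes only the conditional finite-`𝕋⁴` rung `BalabanLadder.UV` —
nothing continuum ∕ ℝ⁴ ∕ OS ∕ mass gap ∕ Clay.  Unit `pub-ymgap-dag-n06-w4` (g4), 2026-08-28.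
-/

noncomputable section

namespace Literature.MathematicalPhysics.QuantumFieldTheory.Balaban1983to89.B9Eq386GreenContinuityZd

open Filter Topology
open B7Prop1Explicit
open B7Prop1Local (pdevOn)
open B7Prop2Explicit (unitaryUnits)
open B8Ineq132 (BondTouches)
open B8Eq131Cubes (sqLo sqHi)
open B8Eq131CubesAdmissible (cubeFam)
open B8CubeMemberZd (cubeLamS)
open B8Ineq159FlatCubeMemberPrinted (cubeLamBP)
open B8LeafModelZd (ZdIdx)
open B9SupplySockB9P3ZdLetters (OpsZd deltaAOf)
open B9SupplySockB9P3ZdLettersOmega (restrictDom restrictDom_of restrictDom_of_not)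
open B9SupplySockB9P3ZdAllLettersZd (opsAllZd)
open B9Eq316AveragingTransposeZd (Reg17 alphaQ tauForm tauForm_apply tauForm_isSymm)
open B9Eq316AveragingTransposeZdLevelZero (linearOnDomAt_opsAllZd_cubeLamBP)
open B9Eq327GreenZd (domSub bondPair LinearOnDomAt setOf_bondTouches_finite finiteDimensional_domSub bondPair_restrictDom_right bondPair_self_pos
  support_finite_of_mem_domSub)
open B9Eq327GreenZdHerm (domSubH domSubH_le RegularAtH gopZdH gopZdH_mem_domSubH restrictLinH restrictLinH_coe_of_herm HermPreservingAt)
open B9Thm311PosDefOpenZd (LettersContinuousWithinAt cubeMember_Ω0_finite eq_zero_of_not_mem_bondFinset)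
open B9Thm311FlatHermKernelZd (bondPair_eq_sum_of_vanish_off)
open B9Thm311PosDefOpenRegimeZd (lettersContinuousWithinAt_opsAllZd_cube_reg17UnivP)
open B9Eq335UnitaryClassCompactZd (continuousWithinAt_bondPair_deltaAOf₂)
open B9Thm311CoerciveCompactZd (exists_coercive_and_regularAtH_of_pdevOn_lt_cube pdevOn_one)
open B9Thm33GreenL2BoundCubeZd (bondPair_self_nonneg_of_vanish_off bondPair_gopZdH_self_le_of_coercive_of_mem)
open B9Eq326DeltaAHermitianZdCurved (linear_herm_on_reg17UnivP one_mem_reg17UnivP)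
open B9Eq386ResolventBoundZd (bondPair_gopZdH_sub_self_le)

export B7Prop1Explicit (Site)

/-! ## §1  Linear algebra: entries `→ 0` ⟹ the form is uniformly small against a positive definite reference form -/

section Abstract

variable {X : Type*} {V : Type*} [AddCommGroup V] [Module ℝ V] [FiniteDimensional ℝ V]

omit [FiniteDimensional ℝ V] in
/-- coordinates: a bilinear form on the vectors with coordinates `c`, `c'` in a basis `b` is the double sum of its entries. [folklore] -/
private theorem bilin_equivFun_symm_eq_sum {n : ℕ} (b : Module.Basis (Fin n) ℝ V) (B : V →ₗ[ℝ] V →ₗ[ℝ] ℝ) (c c' : Fin n → ℝ) :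
    B (b.equivFun.symm c) (b.equivFun.symm c') = ∑ i, ∑ j, c i * c' j * B (b i) (b j) := by
  simp only [Module.Basis.equivFun_symm_apply, map_sum, map_smul, LinearMap.sum_apply, LinearMap.smul_apply, smul_eq_mul,
    Finset.mul_sum]
  rw [Finset.sum_comm]
  refine Finset.sum_congr rfl fun i _ => Finset.sum_congr rfl fun j _ => ?_
  ring

/-- ★★ **ENTRIES TENDING TO ZERO MAKE A BILINEAR FORM UNIFORMLY SMALL AGAINST A POSITIVE DEFINITE REFERENCE FORM** (finite dimension): every entry `x ↦ r x v w`
tends to `0` along `l`, `N` positive definite ⟹ `∀ ε > 0`, eventually along `l`, `|r x v w| ≤ ε·(N v v + N w w)` for ALL `v, w` (coordinate sphere: `N ≥ m > 0`, the `n²`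
entries `< mε∕(n²+1)`, `2‖c‖‖e‖ ≤ ‖c‖² + ‖e‖²`). [cite: Balaban1985BackgroundPropagators, (3.86) p.407 (bookkeeping: the finite-dimensional mechanism behind «convergence in the operator norm»)] -/
theorem eventually_abs_le_of_entries_tendsto_zero (r : X → V →ₗ[ℝ] V →ₗ[ℝ] ℝ) (N : V →ₗ[ℝ] V →ₗ[ℝ] ℝ) {l : Filter X}
    (hr : ∀ v w : V, Tendsto (fun x => r x v w) l (𝓝 0)) (hN : ∀ v : V, v ≠ 0 → 0 < N v v) {ε : ℝ} (hε : 0 < ε) :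
    ∀ᶠ x in l, ∀ v w : V, |r x v w| ≤ ε * (N v v + N w w) := by
  classical
  set n : ℕ := Module.finrank ℝ V with hn
  let b : Module.Basis (Fin n) ℝ V := Module.finBasis ℝ V
  set S : Set (Fin n → ℝ) := Metric.sphere (0 : Fin n → ℝ) 1 with hS
  have hSc : IsCompact S := isCompact_sphere (0 : Fin n → ℝ) 1
  have hf : ContinuousOn (fun c : Fin n → ℝ => ∑ i, ∑ j, c i * c j * N (b i) (b j)) S := by
    refine Continuous.continuousOn ?_
    refine continuous_finsetSum _ fun i _ => continuous_finsetSum _ fun j _ => ?_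
    exact ((continuous_apply i).mul (continuous_apply j)).mul continuous_const
  have hf' : ∀ c ∈ S, (0 : ℝ) < ∑ i, ∑ j, c i * c j * N (b i) (b j) := by
    intro c hc
    rw [← bilin_equivFun_symm_eq_sum b N c c]
    refine hN _ fun h0 => ?_
    have hc0 : c = 0 := by
      have := congrArg b.equivFun h0
      rwa [LinearEquiv.apply_symm_apply, map_zero] at this
    rw [hS, mem_sphere_zero_iff_norm, hc0, norm_zero] at hc
    exact zero_ne_one hc
  obtain ⟨m, hm0, hm⟩ := hSc.exists_forall_le' hf hf'
  set δ : ℝ := m * ε / ((n : ℝ) ^ 2 + 1) with hδ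
  have hδpos : 0 < δ := by positivity
  have hev : ∀ᶠ x in l, ∀ i j : Fin n, |r x (b i) (b j)| < δ := by
    refine eventually_all.2 fun i => eventually_all.2 fun j => ?_
    have h := Metric.tendsto_nhds.1 (hr (b i) (b j)) δ hδpos
    exact h.mono fun x hx => by rwa [Real.dist_eq, sub_zero] at hx
  filter_upwards [hev] with x hx
  have hsph : ∀ c ∈ S, ∀ e ∈ S, |∑ i, ∑ j, c i * e j * r x (b i) (b j)| ≤ (n : ℝ) ^ 2 * δ := by
    intro c hc e he
    have hcc : ∀ i, |c i| ≤ 1 := fun i => by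
      have h1 : ‖c i‖ ≤ ‖c‖ := norm_le_pi_norm c i
      rw [mem_sphere_zero_iff_norm.1 hc] at h1; exact h1
    have hee : ∀ j, |e j| ≤ 1 := fun j => by
      have h1 : ‖e j‖ ≤ ‖e‖ := norm_le_pi_norm e j
      rw [mem_sphere_zero_iff_norm.1 he] at h1; exact h1
    calc |∑ i, ∑ j, c i * e j * r x (b i) (b j)| ≤ ∑ i, |∑ j, c i * e j * r x (b i) (b j)| := Finset.abs_sum_le_sum_abs _ _
      _ ≤ ∑ i, ∑ j, |c i * e j * r x (b i) (b j)| := Finset.sum_le_sum fun i _ => Finset.abs_sum_le_sum_abs _ _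
      _ ≤ ∑ i : Fin n, ∑ j : Fin n, δ := by
          refine Finset.sum_le_sum fun i _ => Finset.sum_le_sum fun j _ => ?_
          rw [abs_mul, abs_mul]
          calc |c i| * |e j| * |r x (b i) (b j)| ≤ 1 * 1 * δ :=
                mul_le_mul (mul_le_mul (hcc i) (hee j) (abs_nonneg _) zero_le_one) (hx i j).le (abs_nonneg _) (by norm_num)
            _ = δ := by ring
      _ = (n : ℝ) ^ 2 * δ := by
          simp only [Finset.sum_const, Finset.card_univ, Fintype.card_fin]
          ring
  intro v w
  by_cases hv : v = 0
  · subst hv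
    simp only [map_zero, LinearMap.zero_apply, abs_zero, zero_add]
    by_cases hw : w = 0
    · subst hw; simp only [map_zero, mul_zero, le_refl]
    · exact mul_nonneg hε.le (hN w hw).le
  by_cases hw : w = 0
  · subst hw
    simp only [map_zero, abs_zero, add_zero]
    exact mul_nonneg hε.le (hN v hv).le
  set cv : Fin n → ℝ := b.equivFun v with hcv
  set cw : Fin n → ℝ := b.equivFun w with hcw
  have hvc : v = b.equivFun.symm cv := by rw [hcv, LinearEquiv.symm_apply_apply]
  have hwc : w = b.equivFun.symm cw := by rw [hcw, LinearEquiv.symm_apply_apply]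
  have hcv0 : cv ≠ 0 := fun h0 => hv (by rw [hvc, h0, map_zero])
  have hcw0 : cw ≠ 0 := fun h0 => hw (by rw [hwc, h0, map_zero])
  set ρ : ℝ := ‖cv‖ with hρ
  set σ : ℝ := ‖cw‖ with hσ
  have hρpos : 0 < ρ := norm_pos_iff.2 hcv0
  have hσpos : 0 < σ := norm_pos_iff.2 hcw0
  set c' : Fin n → ℝ := ρ⁻¹ • cv with hc'
  set e' : Fin n → ℝ := σ⁻¹ • cw with he'
  have hc'S : c' ∈ S := by
    rw [hS, mem_sphere_zero_iff_norm, hc', norm_smul, norm_inv, Real.norm_of_nonneg hρpos.le, inv_mul_cancel₀ hρpos.ne']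
  have he'S : e' ∈ S := by
    rw [hS, mem_sphere_zero_iff_norm, he', norm_smul, norm_inv, Real.norm_of_nonneg hσpos.le, inv_mul_cancel₀ hσpos.ne']
  have hcc' : cv = ρ • c' := by rw [hc', smul_smul, mul_inv_cancel₀ hρpos.ne', one_smul]
  have hee' : cw = σ • e' := by rw [he', smul_smul, mul_inv_cancel₀ hσpos.ne', one_smul]
  have hscale2 : ∀ (B : V →ₗ[ℝ] V →ₗ[ℝ] ℝ) (p q : Fin n → ℝ) (s t : ℝ),
      (∑ i, ∑ j, (s • p) i * (t • q) j * B (b i) (b j)) = s * t * ∑ i, ∑ j, p i * q j * B (b i) (b j) := by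
    intro B p q s t
    rw [Finset.mul_sum]
    refine Finset.sum_congr rfl fun i _ => ?_
    rw [Finset.mul_sum]
    refine Finset.sum_congr rfl fun j _ => ?_
    simp only [Pi.smul_apply, smul_eq_mul]
    ring
  have hr_eq : r x v w = ρ * σ * ∑ i, ∑ j, c' i * e' j * r x (b i) (b j) := by
    rw [hvc, hwc, bilin_equivFun_symm_eq_sum b (r x) cv cw, hcc', hee', hscale2]
  have hNv : ρ ^ 2 * m ≤ N v v := by
    rw [hvc, bilin_equivFun_symm_eq_sum b N cv cv, hcc', hscale2, ← pow_two]
    exact mul_le_mul_of_nonneg_left (hm c' hc'S) (by positivity)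
  have hNw : σ ^ 2 * m ≤ N w w := by
    rw [hwc, bilin_equivFun_symm_eq_sum b N cw cw, hee', hscale2, ← pow_two]
    exact mul_le_mul_of_nonneg_left (hm e' he'S) (by positivity)
  have h1 : |r x v w| ≤ ρ * σ * ((n : ℝ) ^ 2 * δ) := by
    rw [hr_eq, abs_mul, abs_of_pos (mul_pos hρpos hσpos)]
    exact mul_le_mul_of_nonneg_left (hsph c' hc'S e' he'S) (mul_pos hρpos hσpos).le
  have h2 : ρ * σ ≤ (ρ ^ 2 + σ ^ 2) / 2 := by nlinarith [sq_nonneg (ρ - σ)]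
  have hn2 : (n : ℝ) ^ 2 * δ ≤ m * ε := by
    rw [hδ]
    have hpos : (0 : ℝ) < (n : ℝ) ^ 2 + 1 := by positivity
    rw [← mul_div_assoc, div_le_iff₀ hpos]
    nlinarith [hm0, hε, sq_nonneg (n : ℝ)]
  have h3 : ρ * σ * ((n : ℝ) ^ 2 * δ) ≤ (ρ ^ 2 + σ ^ 2) / 2 * (m * ε) :=
    mul_le_mul h2 hn2 (by positivity) (by positivity)
  have h4a : (ρ ^ 2 + σ ^ 2) * m ≤ N v v + N w w := by linarith
  have hNpos : 0 ≤ N v v + N w w := le_trans (by positivity) h4a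
  have h4 : (ρ ^ 2 + σ ^ 2) / 2 * (m * ε) ≤ ε * (N v v + N w w) := by
    rw [show (ρ ^ 2 + σ ^ 2) / 2 * (m * ε) = (ε / 2) * ((ρ ^ 2 + σ ^ 2) * m) by ring]
    calc (ε / 2) * ((ρ ^ 2 + σ ^ 2) * m) ≤ (ε / 2) * (N v v + N w w) := mul_le_mul_of_nonneg_left h4a (by positivity)
      _ ≤ ε * (N v v + N w w) := by nlinarith
  linarith

end Abstract

/-! ## §2  The carrier: `G_𝔤` is continuous in the background in `L²_τ`-operator norm along a coercive, regular, continuous family -/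

section Carrier

variable {d : ℕ} {𝔸 : Type*} [CStarAlgebra 𝔸] [FiniteDimensional ℝ 𝔸]
variable (τ : 𝔸 →ₗ[ℂ] ℂ) (hτp : ∀ a : 𝔸, a ≠ 0 → 0 < (τ (star a * a)).re) (hτs : ∀ a : 𝔸, τ (star a) = starRingEnd ℂ (τ a))

include hτp hτs in
/-- ★★★ **THE GENUINE PROPAGATOR IS CONTINUOUS IN THE BACKGROUND IN `L²_τ`-OPERATOR NORM** (ANY record `o`, finite `Ω₀`, faithful Hermitian `τ`): on a set `S`
where `Δ_a(U)↾Ω₀` is invertible on `E_𝔤(Ω₀)`, ℝ-linear on `E(Ω₀)`, Hermiticity-preserving, UNIFORMLY `c`-coercive, with letters continuous within `S` at `V ∈ S`: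
`∀ ε > 0`, for all `U ∈ S` near `V`, `⟨G_𝔤(U)J − G_𝔤(V)J, ·⟩_τ ≤ ε·⟨J, J⟩_τ` for EVERY `J ∈ E_𝔤(Ω₀)` (resolvent identity + `‖G_𝔤(U)‖ ≤ c⁻¹` + §1).
[cite: Balaban1985BackgroundPropagators, (3.84)–(3.86) p.407, Thm 3.11 p.416 (proof); Balaban1984PropagatorsII, (2.22) p.226] -/
theorem eventually_bondPair_gopZdH_sub_le {η : ℝ} {o : OpsZd d 𝔸} {Ω₀ : Set (Site d)} (hΩ : Ω₀.Finite) {S : Set (Site d → Fin d → 𝔸ˣ)}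
    {V : Site d → Fin d → 𝔸ˣ} (hV : V ∈ S) (hreg : ∀ U ∈ S, RegularAtH η o Ω₀ U) (hlin : ∀ U ∈ S, LinearOnDomAt η o Ω₀ U)
    (hherm : ∀ U ∈ S, HermPreservingAt η o Ω₀ U) {c : ℝ} (hc : 0 < c)
    (hcoer : ∀ U ∈ S, ∀ A ∈ domSubH (𝔸 := 𝔸) Ω₀, c * bondPair τ A A ≤ bondPair τ A (deltaAOf η o U A))
    (hcont : LettersContinuousWithinAt η o Ω₀ (domSubH Ω₀) S V) {ε : ℝ} (hε : 0 < ε) :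
    ∀ᶠ U in 𝓝[S] V, ∀ J ∈ domSubH (𝔸 := 𝔸) Ω₀,
      bondPair τ (gopZdH η o Ω₀ U J - gopZdH η o Ω₀ V J) (gopZdH η o Ω₀ U J - gopZdH η o Ω₀ V J) ≤ ε * bondPair τ J J := by
  classical
  haveI : FiniteDimensional ℝ (domSub (𝔸 := 𝔸) Ω₀) := finiteDimensional_domSub hΩ
  let W : Submodule ℝ (Site d → Fin d → 𝔸) := domSubH Ω₀
  have hW : W ≤ domSub (𝔸 := 𝔸) Ω₀ := domSubH_le Ω₀
  haveI : FiniteDimensional ℝ W := Submodule.finiteDimensional_of_le hW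
  have hlin' := hlin
  choose! T hT using hlin'
  let Tb : Finset (Site d × Fin d) := (setOf_bondTouches_finite (d := d) hΩ).toFinset
  have hTb : ∀ A ∈ W, ∀ b : Site d × Fin d, b ∉ Tb → A b.1 b.2 = 0 :=
    fun A hA b hb => eq_zero_of_not_mem_bondFinset hΩ (hW hA) b hb
  have hTbW : ∀ A : Site d → Fin d → 𝔸, A ∈ domSub (𝔸 := 𝔸) Ω₀ → ∀ b : Site d × Fin d, b ∉ Tb → A b.1 b.2 = 0 :=
    fun A hA b hb => eq_zero_of_not_mem_bondFinset hΩ hA b hb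
  let ev : Site d × Fin d → ((Site d → Fin d → 𝔸) →ₗ[ℝ] 𝔸) := fun b =>
    (LinearMap.proj (R := ℝ) (φ := fun _ : Fin d => 𝔸) b.2).comp (LinearMap.proj (R := ℝ) (φ := fun _ : Site d => Fin d → 𝔸) b.1)
  let q : (Site d → Fin d → 𝔸ˣ) → W →ₗ[ℝ] W →ₗ[ℝ] ℝ := fun U =>
    ∑ b ∈ Tb, (tauForm τ).compl₁₂ ((ev b).comp W.subtype) ((ev b).comp ((T U).comp W.subtype))
  let r : (Site d → Fin d → 𝔸ˣ) → W →ₗ[ℝ] W →ₗ[ℝ] ℝ := fun U => q U - q V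
  let N : W →ₗ[ℝ] W →ₗ[ℝ] ℝ := ∑ b ∈ Tb, (tauForm τ).compl₁₂ ((ev b).comp W.subtype) ((ev b).comp W.subtype)
  have hq : ∀ U (A B : W), q U A B = ∑ b ∈ Tb, tauForm τ ((A : Site d → Fin d → 𝔸) b.1 b.2) (T U B b.1 b.2) := by
    intro U A B
    simp only [q, LinearMap.sum_apply, LinearMap.compl₁₂_apply, LinearMap.comp_apply, Submodule.subtype_apply, ev, LinearMap.proj_apply]
  have hN : ∀ A B : W, N A B = ∑ b ∈ Tb, tauForm τ ((A : Site d → Fin d → 𝔸) b.1 b.2) ((B : Site d → Fin d → 𝔸) b.1 b.2) := by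
    intro A B
    simp only [N, LinearMap.sum_apply, LinearMap.compl₁₂_apply, LinearMap.comp_apply, Submodule.subtype_apply, ev, LinearMap.proj_apply]
  have hqS : ∀ U ∈ S, ∀ A B : W, q U A B = bondPair τ (A : Site d → Fin d → 𝔸) (deltaAOf η o U B) := by
    intro U hU A B
    rw [hq, bondPair_eq_sum_of_vanish_off τ Tb (hTb A A.2)]
    exact Finset.sum_congr rfl fun b _ => by rw [hT U hU B (hW B.2)]
  have hNA : ∀ A : W, N A A = bondPair τ (A : Site d → Fin d → 𝔸) A := by
    intro A; rw [hN, bondPair_eq_sum_of_vanish_off τ Tb (hTb A A.2)]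
  have hNpos : ∀ A : W, A ≠ 0 → 0 < N A A := by
    intro A hA
    rw [hNA]
    exact bondPair_self_pos τ hτp (fun μ => support_finite_of_mem_domSub hΩ (hW A.2) μ) fun h => hA (Subtype.ext h)
  have hr : ∀ A B : W, Tendsto (fun U => r U A B) (𝓝[S] V) (𝓝 0) := by
    intro A B
    have hcAB : ContinuousWithinAt (fun U => bondPair τ (A : Site d → Fin d → 𝔸) (deltaAOf η o U B)) S V :=
      continuousWithinAt_bondPair_deltaAOf₂ τ hΩ hcont (hW A.2) B.2
    have h1 : Tendsto (fun U => bondPair τ (A : Site d → Fin d → 𝔸) (deltaAOf η o U B) - bondPair τ (A : Site d → Fin d → 𝔸) (deltaAOf η o V B))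
        (𝓝[S] V) (𝓝 0) := by
      have := hcAB.tendsto.sub_const (bondPair τ (A : Site d → Fin d → 𝔸) (deltaAOf η o V B))
      rwa [sub_self] at this
    refine h1.congr' ?_
    filter_upwards [eventually_mem_nhdsWithin] with U hU
    show _ = (q U - q V) A B
    rw [LinearMap.sub_apply, LinearMap.sub_apply, hqS U hU, hqS V hV]
  set ε₁ : ℝ := min (1 / 2) (ε * c ^ 4 / 2) with hε₁
  have hε₁pos : 0 < ε₁ := lt_min (by norm_num) (by positivity)
  have hε₁half : ε₁ ≤ 1 / 2 := min_le_left _ _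
  have hε₁le : ε₁ ≤ ε * c ^ 4 / 2 := min_le_right _ _
  have hev := eventually_abs_le_of_entries_tendsto_zero r N hr hNpos hε₁pos
  filter_upwards [hev, eventually_mem_nhdsWithin] with U hU hUS
  intro J hJ
  set B : Site d → Fin d → 𝔸 := gopZdH η o Ω₀ V J with hBdef
  set D : Site d → Fin d → 𝔸 := gopZdH η o Ω₀ U J - gopZdH η o Ω₀ V J with hDdef
  have hB : B ∈ W := gopZdH_mem_domSubH η o Ω₀ V J
  set X : Site d → Fin d → 𝔸 := deltaAOf η o V B - deltaAOf η o U B with hXdef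
  set Wt : Site d → Fin d → 𝔸 := (restrictLinH (𝔸 := 𝔸) Ω₀ X : Site d → Fin d → 𝔸) with hWt
  have hWtmem : Wt ∈ W := (restrictLinH (𝔸 := 𝔸) Ω₀ X).2
  have hXherm : ∀ (y : Site d) (μ : Fin d), BondTouches Ω₀ y μ → IsSelfAdjoint (X y μ) := by
    intro y μ hb
    rw [hXdef, Pi.sub_apply, Pi.sub_apply]
    exact (hherm V hV B hB y μ hb).sub (hherm U hUS B hB y μ hb)
  have hWtX : Wt = restrictDom Ω₀ X := by rw [hWt, restrictLinH_coe_of_herm Ω₀ hXherm]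
  have h5 : bondPair τ D D ≤ c⁻¹ ^ 2 * bondPair τ Wt Wt :=
    bondPair_gopZdH_sub_self_le τ hτp hτs η o Ω₀ hΩ (hreg U hUS) (hreg V hV) (hlin U hUS) hc (hcoer U hUS) J
  have hWW : bondPair τ Wt Wt = -(r U ⟨Wt, hWtmem⟩ ⟨B, hB⟩) := by
    have h1 : bondPair τ Wt Wt = bondPair τ Wt X := by
      conv_lhs => rw [hWtX]
      conv_rhs => rw [hWtX]
      exact bondPair_restrictDom_right τ (B9Eq327GreenZd.restrictDom_mem_domSub Ω₀ X) X
    rw [h1, show r U ⟨Wt, hWtmem⟩ ⟨B, hB⟩ = q U ⟨Wt, hWtmem⟩ ⟨B, hB⟩ - q V ⟨Wt, hWtmem⟩ ⟨B, hB⟩ from rfl, hqS U hUS, hqS V hV]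
    rw [hXdef, bondPair_eq_sum_of_vanish_off τ Tb (hTb Wt hWtmem), bondPair_eq_sum_of_vanish_off τ Tb (hTb Wt hWtmem),
      bondPair_eq_sum_of_vanish_off τ Tb (hTb Wt hWtmem), ← Finset.sum_sub_distrib, ← Finset.sum_neg_distrib]
    refine Finset.sum_congr rfl fun b _ => ?_
    rw [Pi.sub_apply, Pi.sub_apply, map_sub]
    ring
  have hWWle : bondPair τ Wt Wt ≤ ε₁ * (bondPair τ Wt Wt + bondPair τ B B) := by
    have h := hU ⟨Wt, hWtmem⟩ ⟨B, hB⟩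
    rw [hNA, hNA] at h
    have h' : -(r U ⟨Wt, hWtmem⟩ ⟨B, hB⟩) ≤ |r U ⟨Wt, hWtmem⟩ ⟨B, hB⟩| := neg_le_abs _
    linarith [hWW]
  have hBB : bondPair τ B B ≤ c⁻¹ ^ 2 * bondPair τ J J :=
    bondPair_gopZdH_self_le_of_coercive_of_mem τ hτp hτs η o Ω₀ V hΩ (hreg V hV) hc (hcoer V hV) hJ
  have hWtnn : 0 ≤ bondPair τ Wt Wt := bondPair_self_nonneg_of_vanish_off τ hτp Tb (hTb Wt hWtmem)
  have hJJ : 0 ≤ bondPair τ J J := bondPair_self_nonneg_of_vanish_off τ hτp Tb (hTb J hJ)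
  have hWt2 : bondPair τ Wt Wt ≤ 2 * ε₁ * bondPair τ B B := by nlinarith [hWWle, hε₁half, hWtnn]
  have hc2 : 0 < c⁻¹ ^ 2 := by positivity
  have hchain : bondPair τ D D ≤ c⁻¹ ^ 2 * (2 * ε₁ * (c⁻¹ ^ 2 * bondPair τ J J)) := by
    calc bondPair τ D D ≤ c⁻¹ ^ 2 * bondPair τ Wt Wt := h5
      _ ≤ c⁻¹ ^ 2 * (2 * ε₁ * bondPair τ B B) := mul_le_mul_of_nonneg_left hWt2 hc2.le
      _ ≤ c⁻¹ ^ 2 * (2 * ε₁ * (c⁻¹ ^ 2 * bondPair τ J J)) :=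
          mul_le_mul_of_nonneg_left (mul_le_mul_of_nonneg_left hBB (by positivity)) hc2.le
  have hconst : c⁻¹ ^ 2 * (2 * ε₁ * (c⁻¹ ^ 2 * bondPair τ J J)) ≤ ε * bondPair τ J J := by
    have hcc : c⁻¹ ^ 2 * (2 * ε₁ * (c⁻¹ ^ 2 * bondPair τ J J)) = (2 * ε₁ * (c ^ 4)⁻¹) * bondPair τ J J := by
      field_simp
    rw [hcc]
    refine mul_le_mul_of_nonneg_right ?_ hJJ
    have hc4 : 0 < c ^ 4 := by positivity
    rw [mul_inv_le_iff₀ hc4]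
    linarith
  exact hchain.trans hconst

end Carrier

/-! ## §3  Cube members: `G_𝔤(U₀) → G_𝔤(V)` in `L²_τ`-operator norm along the small-field class near the member -/

section Cube

variable {d : ℕ} {𝔸 : Type*} [CStarAlgebra 𝔸] [FiniteDimensional ℝ 𝔸] [Nontrivial 𝔸] {L : ℕ}
variable (τ : 𝔸 →ₗ[ℂ] ℂ) (hτp : ∀ a : 𝔸, a ≠ 0 → 0 < (τ (star a * a)).re)
  (hτt : ∀ a b : 𝔸, τ (a * b) = τ (b * a)) (hτs : ∀ a : 𝔸, τ (star a) = starRingEnd ℂ (τ a))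

include hτp hτt hτs in
/-- ★★★★ **AT ONE CUBE MEMBER, ALONG THE SMALL-FIELD CLASS, THE GENUINE PROPAGATOR IS CONTINUOUS IN THE BACKGROUND IN `L²_τ`-OPERATOR NORM**: at a cube member of
[Balaban1985RegularSpaces] (1.131) (`Ω = cubeFam false L a Mc ρ k`, `Λs = cubeLamS …`, `m ≤ k`, `2 ≤ d`, `2 ≤ L ≤ ρ`), print's class `cubeLamBP`, faithful Hermitian tracial
`τ` on a finite-dimensional fibre, there is `α > 0` (the member's, from `B9Thm311CoerciveCompactZd`) such that on the class
`S = {U₀ unitary, (1.7) on ℤᵈ at window α_Q∕L², pdevOn(□₀ ± 3) U₀ < α}`: for every `V ∈ S` and every `ε > 0`, for all `U₀ ∈ S` near `V`,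
`⟨G_𝔤(U₀)J − G_𝔤(V)J, G_𝔤(U₀)J − G_𝔤(V)J⟩_τ ≤ ε·⟨J, J⟩_τ` for EVERY Hermitian `J ∈ E(□₀)` — `G_𝔤 = gopZdH` of the genuine four-letter `Δ_a` of `opsAllZd`.
[cite: Balaban1985BackgroundPropagators, (3.86) p.407, Thm 3.11 p.416, (3.27) p.395; Balaban1985RegularSpaces, (1.7) p.77, (1.131) p.99] -/
theorem eventually_bondPair_gopZdH_sub_le_cube (hd2 : 2 ≤ d) (hL : 2 ≤ L) (ops₀ : ℝ → ZdIdx d L → ℕ → OpsZd d 𝔸) (M : ℝ) (i : ZdIdx d L)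
    {a : Site d} {Mc ρ : ℕ} (hρ : L ≤ ρ) (hΩ : i.Ω = cubeFam false L a Mc ρ i.k) (hΛs : i.Λs = cubeLamS L a Mc ρ i.k) {m : ℕ} (hm : m ≤ i.k) :
    ∃ α : ℝ, 0 < α ∧ ∀ V ∈ {U₀ : Site d → Fin d → 𝔸ˣ | ((∀ x κ, U₀ x κ ∈ unitaryUnits 𝔸) ∧
        Reg17 L m (fun _ => (Set.univ : Set (Site d))) (alphaQ d L / (L : ℝ) ^ 2) U₀) ∧
        pdevOn (fun i' => sqLo L a ρ i.k 0 i' - 3) (fun i' => sqHi L a Mc ρ i.k 0 i' + 3) U₀ < α},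
      ∀ ε : ℝ, 0 < ε →
        ∀ᶠ U₀ in 𝓝[{U₀ : Site d → Fin d → 𝔸ˣ | ((∀ x κ, U₀ x κ ∈ unitaryUnits 𝔸) ∧
            Reg17 L m (fun _ => (Set.univ : Set (Site d))) (alphaQ d L / (L : ℝ) ^ 2) U₀) ∧
            pdevOn (fun i' => sqLo L a ρ i.k 0 i' - 3) (fun i' => sqHi L a Mc ρ i.k 0 i' + 3) U₀ < α}] V,
          ∀ J ∈ domSubH (𝔸 := 𝔸) (i.Ω 0),
            bondPair τ
                (gopZdH i.η (opsAllZd τ L (cubeLamBP L a Mc ρ i.k) ops₀ M i m) (i.Ω 0) U₀ J -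
                  gopZdH i.η (opsAllZd τ L (cubeLamBP L a Mc ρ i.k) ops₀ M i m) (i.Ω 0) V J)
                (gopZdH i.η (opsAllZd τ L (cubeLamBP L a Mc ρ i.k) ops₀ M i m) (i.Ω 0) U₀ J -
                  gopZdH i.η (opsAllZd τ L (cubeLamBP L a Mc ρ i.k) ops₀ M i m) (i.Ω 0) V J) ≤ ε * bondPair τ J J := by
  haveI : NeZero L := ⟨by omega⟩
  have hfin : (i.Ω 0).Finite := cubeMember_Ω0_finite i hΩ
  obtain ⟨α, hα, c, hc, h⟩ := exists_coercive_and_regularAtH_of_pdevOn_lt_cube τ hτp hτt hτs hd2 hL ops₀ M i hρ hΩ hΛs hm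
  refine ⟨α, hα, fun V hV ε hε => ?_⟩
  have hstr := linear_herm_on_reg17UnivP τ hτt hτs hτp hL (cubeLamBP L a Mc ρ i.k) ops₀ M i m hfin
  have hsub : {U₀ : Site d → Fin d → 𝔸ˣ | ((∀ x κ, U₀ x κ ∈ unitaryUnits 𝔸) ∧
        Reg17 L m (fun _ => (Set.univ : Set (Site d))) (alphaQ d L / (L : ℝ) ^ 2) U₀) ∧
        pdevOn (fun i' => sqLo L a ρ i.k 0 i' - 3) (fun i' => sqHi L a Mc ρ i.k 0 i' + 3) U₀ < α} ⊆
      {U₀ : Site d → Fin d → 𝔸ˣ | (∀ x κ, U₀ x κ ∈ unitaryUnits 𝔸) ∧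
        Reg17 L m (fun _ => (Set.univ : Set (Site d))) (alphaQ d L / (L : ℝ) ^ 2) U₀} := fun U hU => hU.1
  exact eventually_bondPair_gopZdH_sub_le τ hτp hτs hfin hV (fun U hU => (h U hU.1.1 hU.2).2.1) (fun U hU => hstr.1 U hU.1)
    (fun U hU => hstr.2 U hU.1) hc (fun U hU => (h U hU.1.1 hU.2).1)
    ((lettersContinuousWithinAt_opsAllZd_cube_reg17UnivP τ hτp hτt hτs hd2 hL (cubeLamBP L a Mc ρ i.k) ops₀ M i hΩ hΛs hρ hm hV.1).mono_set hsub) hε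

include hτp hτt hτs in
/-- ★★★ **THE CURVED PROPAGATOR TENDS TO THE FLAT ONE IN OPERATOR NORM AS THE BACKGROUND FLATTENS** (the reading at `V = 1`, which lies in the class at every member):
`∀ ε > 0`, for all `U₀` of the class near `1`, `⟨G_𝔤(U₀)J − G_𝔤(1)J, ·⟩_τ ≤ ε·⟨J, J⟩_τ` for every Hermitian `J ∈ E(□₀)` — (3.86)'s «G(U) = G(1) + small» at
the `ℤᵈ` frame, qualitatively. [cite: Balaban1985BackgroundPropagators, (3.86) p.407, Thm 3.11 p.416 («G_□(e^{iηA}) = G_□(1)(I − V(A)G_□(1))⁻¹»); Balaban1984PropagatorsII, (2.11) p.225] -/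
theorem eventually_bondPair_gopZdH_sub_one_le_cube (hd2 : 2 ≤ d) (hL : 2 ≤ L) (ops₀ : ℝ → ZdIdx d L → ℕ → OpsZd d 𝔸) (M : ℝ) (i : ZdIdx d L)
    {a : Site d} {Mc ρ : ℕ} (hρ : L ≤ ρ) (hΩ : i.Ω = cubeFam false L a Mc ρ i.k) (hΛs : i.Λs = cubeLamS L a Mc ρ i.k) {m : ℕ} (hm : m ≤ i.k) :
    ∃ α : ℝ, 0 < α ∧ ∀ ε : ℝ, 0 < ε →
      ∀ᶠ U₀ in 𝓝[{U₀ : Site d → Fin d → 𝔸ˣ | ((∀ x κ, U₀ x κ ∈ unitaryUnits 𝔸) ∧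
          Reg17 L m (fun _ => (Set.univ : Set (Site d))) (alphaQ d L / (L : ℝ) ^ 2) U₀) ∧
          pdevOn (fun i' => sqLo L a ρ i.k 0 i' - 3) (fun i' => sqHi L a Mc ρ i.k 0 i' + 3) U₀ < α}] 1,
        ∀ J ∈ domSubH (𝔸 := 𝔸) (i.Ω 0),
          bondPair τ
              (gopZdH i.η (opsAllZd τ L (cubeLamBP L a Mc ρ i.k) ops₀ M i m) (i.Ω 0) U₀ J -
                gopZdH i.η (opsAllZd τ L (cubeLamBP L a Mc ρ i.k) ops₀ M i m) (i.Ω 0) 1 J)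
              (gopZdH i.η (opsAllZd τ L (cubeLamBP L a Mc ρ i.k) ops₀ M i m) (i.Ω 0) U₀ J -
                gopZdH i.η (opsAllZd τ L (cubeLamBP L a Mc ρ i.k) ops₀ M i m) (i.Ω 0) 1 J) ≤ ε * bondPair τ J J := by
  have hL1 : 1 ≤ L := le_trans one_le_two hL
  obtain ⟨α, hα, h⟩ := eventually_bondPair_gopZdH_sub_le_cube τ hτp hτt hτs hd2 hL ops₀ M i hρ hΩ hΛs hm
  refine ⟨α, hα, fun ε hε => h 1 ⟨one_mem_reg17UnivP hL1 m, ?_⟩ ε hε⟩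
  show pdevOn _ _ (1 : Site d → Fin d → 𝔸ˣ) < α
  rw [pdevOn_one]; exact hα

end Cube

end Literature.MathematicalPhysics.QuantumFieldTheory.Balaban1983to89.B9Eq386GreenContinuityZd

end
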